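import Literature.Geometry.Lorentzian.CompleteSpacelikeGraph
import HarnessLib

/-!
# Distances on a complete spacelike hypersurface are bounded by spatial coordinate distances

For a connected Hausdorff `3`-manifold `X` with a complete smooth Riemannian metric `h` and a
smooth `f : X → (ℝ⁴, η)` with `f^*η = h`, the spatial projection `Φ = f̲` is a diffeomorphism
`X ≅ ℝ³` (`Minkowski.exists_diffeomorph_eq_spatial`, `CompleteSpacelikeGraph.lean`) and `h` is
dominated by `Φ^*δ` (`η(w, w) ≤ ‖w̲‖²`). Hence the `h`-length of the `Φ`-preimage of a straight
segment is at most its Euclidean length: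

* `Minkowski.edist_le_norm_spatial_sub` — **`d_h(a, b) ≤ ‖f(b)̲ − f(a)̲‖`** for all `a, b ∈ X`.

In the proof of the rigid positive energy theorem (Beig–Chruściel, J. Math. Phys. 37 (1996),
Thm. 4.1, §4) this bounds the displacement of a deck transformation of the universal cover of
the data manifold (which translates the spatial coordinates by a constant vector) uniformly,
which is incompatible with large well-covered balls far out in an asymptotically flat end unless
the cover is trivial. Theorems only; no definitions, no named facts.

## References

* R. Beig, P. T. Chruściel, J. Math. Phys. 37 (1996) 1939–1961, proof of Thm. 4.1, §4.
  [BeigChrusciel1996]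
* B. O'Neill, *Semi-Riemannian geometry*, Academic Press 1983, Ch. 5, Def. 11 and Def. 15.
  [ONeill1983]
-/

noncomputable section

open Bundle Set Function Filter Manifold MeasureTheory
open scoped Manifold ContDiff Topology

namespace Literature.Geometry.Lorentzian

namespace Minkowski

variable {X : Type*} [TopologicalSpace X] [ChartedSpace E3 X] [IsManifold (𝓡 3) ∞ X]
  {f : X → E4} {h : PseudoRiemannianMetric (𝓡 3) ∞ E3 (TangentSpace (𝓡 3) : X → Type _)}
  [T2Space X] [ConnectedSpace X] [h.HasLeviCivita]

/-- **On a complete spacelike hypersurface of Minkowski space-time, intrinsic distances are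
bounded by spatial coordinate distances**: `d_h(a, b) ≤ ‖f(b)̲ − f(a)̲‖`. With the
diffeomorphism `Φ = f̲ : X ≅ ℝ³` (`exists_diffeomorph_eq_spatial`), the curve
`σ(t) = Φ⁻¹(Φ a + t (Φ b − Φ a))` joins `a` to `b` and has `h`-speed
`h(σ', σ')^{1/2} ≤ ‖dΦ σ'‖ = ‖Φ b − Φ a‖` (`η(w, w) ≤ ‖w̲‖²`, `bilin_self_le_norm_spatial_sq`),
so its `h`-length is at most `‖Φ b − Φ a‖` (O'Neill 1983, Ch. 5, Def. 11, Def. 15).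
[cite: ONeill1983, Ch. 5, Def. 15 (p. 134)] -/
theorem edist_le_norm_spatial_sub (hf : ContMDiff (𝓡 3) 𝓘(ℝ, E4) ∞ f) (hpos : h.IsRiemannian)
    (hiso : ∀ (x : X) (v w : TangentSpace (𝓡 3) x),
      bilin (mfderiv (𝓡 3) 𝓘(ℝ, E4) f x v) (mfderiv (𝓡 3) 𝓘(ℝ, E4) f x w) = h.val x v w)
    (hc : IsGeodesicallyComplete h.leviCivita) (a b : X) :
    h.edist hpos a b ≤ ENNReal.ofReal ‖E4.spatial (f b) - E4.spatial (f a)‖ := by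
  obtain ⟨Φ, hΦ⟩ := exists_diffeomorph_eq_spatial hf hpos hiso hc
  have hΦeq : (Φ : X → E3) = fun x ↦ E4.spatial (f x) := funext hΦ
  set c : E3 := Φ b - Φ a with hcdef
  have hc' : E4.spatial (f b) - E4.spatial (f a) = c := by rw [hcdef, hΦ, hΦ]
  rw [hc']
  -- the preimage of the straight segment
  set ℓ : ℝ → E3 := fun t ↦ Φ a + t • c with hℓ
  set σ : ℝ → X := fun t ↦ Φ.symm (ℓ t) with hσ
  have hℓd : ∀ t, HasMFDerivAt 𝓘(ℝ, ℝ) 𝓘(ℝ, E3) ℓ t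
      (ContinuousLinearMap.smulRight (1 : ℝ →L[ℝ] ℝ) c) := fun t ↦ by
    rw [hasMFDerivAt_iff_hasFDerivAt]
    exact ((hasFDerivAt_id t).smul_const c).const_add (Φ a)
  have hℓs : ContMDiff 𝓘(ℝ, ℝ) 𝓘(ℝ, E3) ∞ ℓ :=
    contMDiff_iff_contDiff.2 (contDiff_const.add (contDiff_id.smul contDiff_const))
  have hσs : ContMDiff 𝓘(ℝ, ℝ) (𝓡 3) ∞ σ := Φ.symm.contMDiff.comp hℓs
  have hσ0 : σ 0 = a := by simp [hσ, hℓ]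
  have hσ1 : σ 1 = b := by simp [hσ, hℓ, hcdef]
  -- `dΦ (σ' t) = c`
  have hfx : ∀ x, MDifferentiableAt (𝓡 3) 𝓘(ℝ, E4) f x := fun x ↦ hf.mdifferentiableAt (by simp)
  have hdσ : ∀ t, E4.spatial (mfderiv (𝓡 3) 𝓘(ℝ, E4) f (σ t) (mfderiv 𝓘(ℝ, ℝ) (𝓡 3) σ t 1)) =
      c := by
    intro t
    have h1 : HasMFDerivAt 𝓘(ℝ, ℝ) 𝓘(ℝ, E3) (Φ ∘ σ) t
        ((mfderiv (𝓡 3) 𝓘(ℝ, E3) Φ (σ t)).comp (mfderiv 𝓘(ℝ, ℝ) (𝓡 3) σ t)) :=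
      (Φ.contMDiff.mdifferentiableAt (by simp)).hasMFDerivAt.comp t
        (hσs.mdifferentiableAt (by simp)).hasMFDerivAt
    have h2 : Φ ∘ σ = ℓ := funext fun t ↦ by simp [hσ]
    rw [h2] at h1
    have h3 := congrArg (fun L : TangentSpace 𝓘(ℝ, ℝ) t →L[ℝ] TangentSpace 𝓘(ℝ, E3) (ℓ t) ↦ L 1)
      ((hℓd t).mfderiv.symm.trans h1.mfderiv)
    simp only [ContinuousLinearMap.smulRight_apply] at h3
    have h4 : (mfderiv (𝓡 3) 𝓘(ℝ, E3) Φ (σ t)) (mfderiv 𝓘(ℝ, ℝ) (𝓡 3) σ t 1) = c := by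
      have h5 : ((1 : ℝ →L[ℝ] ℝ) 1 • c : E3) = c := by simp
      exact h3.symm.trans h5
    rw [← mfderiv_spatial_comp_apply (hfx _), ← hΦeq]
    exact h4
  -- pointwise speed bound `h(σ', σ')^{1/2} ≤ ‖c‖`
  have hspeed : ∀ t, Real.sqrt (h.val (σ t) (mfderiv 𝓘(ℝ, ℝ) (𝓡 3) σ t 1)
      (mfderiv 𝓘(ℝ, ℝ) (𝓡 3) σ t 1)) ≤ ‖c‖ := by
    intro t
    rw [← hiso, ← hdσ t]
    calc Real.sqrt (bilin (mfderiv (𝓡 3) 𝓘(ℝ, E4) f (σ t) (mfderiv 𝓘(ℝ, ℝ) (𝓡 3) σ t 1))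
          (mfderiv (𝓡 3) 𝓘(ℝ, E4) f (σ t) (mfderiv 𝓘(ℝ, ℝ) (𝓡 3) σ t 1)))
        ≤ Real.sqrt (‖E4.spatial (mfderiv (𝓡 3) 𝓘(ℝ, E4) f (σ t)
            (mfderiv 𝓘(ℝ, ℝ) (𝓡 3) σ t 1))‖ ^ 2) :=
          Real.sqrt_le_sqrt (bilin_self_le_norm_spatial_sq _)
      _ = ‖E4.spatial (mfderiv (𝓡 3) 𝓘(ℝ, E4) f (σ t) (mfderiv 𝓘(ℝ, ℝ) (𝓡 3) σ t 1))‖ :=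
          Real.sqrt_sq (norm_nonneg _)
  -- the length of `σ`
  have hlen : h.length hpos σ 0 1 ≤ ENNReal.ofReal ‖c‖ := by
    rw [PseudoRiemannianMetric.length_eq_lintegral]
    calc ∫⁻ t in Icc (0 : ℝ) 1, ENNReal.ofReal (Real.sqrt (h.val (σ t)
            (mfderiv 𝓘(ℝ, ℝ) (𝓡 3) σ t 1) (mfderiv 𝓘(ℝ, ℝ) (𝓡 3) σ t 1)))
        ≤ ∫⁻ _ in Icc (0 : ℝ) 1, ENNReal.ofReal ‖c‖ :=
          lintegral_mono fun t ↦ ENNReal.ofReal_le_ofReal (hspeed t)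
      _ = ENNReal.ofReal ‖c‖ := by
          rw [setLIntegral_const, Real.volume_Icc, sub_zero, ENNReal.ofReal_one, mul_one]
  calc h.edist hpos a b = h.edist hpos (σ 0) (σ 1) := by rw [hσ0, hσ1]
    _ ≤ h.length hpos σ 0 1 :=
        PseudoRiemannianMetric.edist_le_length hpos zero_le_one (hσs.of_le (by exact_mod_cast le_top)).contMDiffOn
    _ ≤ ENNReal.ofReal ‖c‖ := hlen

end Minkowski

end Literature.Geometry.Lorentzian

end
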